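import Summits.BirchSwinnertonDyer.BirchSwinnertonDyer.Theorems.GenusKolyvaginAtTwoMinimalTwinBSDTwoOddCutOfTranspositionWitness
import HarnessLib

/-!
# Route `GenusKolyvaginAtTwo`, crux U₂ `MinimalTwinBSDTwo` (stmt-BirchSwinnertonDyer-22985), LINE 23 «twin_swap» — THE DEPTH-ZERO FRAMES OF THE
# ODD HABITAT CUT: there the transposition-witness supply SUPPLY^± is the frame itself (`n = 1`), so U₂ ⟸ WALL row 1 + PRINT + Q2 + «one odd Heegner
# frame inside the genus budget at which `y_K ∉ 2W(K[1])`»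

Seat `bsd-line-gk2-p2` g32 (PROVER seat 2/3, cell `bsd-f1-sign2`, LINE 23 holder), `--supports stmt-BirchSwinnertonDyer-22985 --as helper`.
THEOREMS ONLY (no definition, no named fact, no `sorry`).  BSD is NOT proved by any of this; U₂ is NOT proved; nothing is closed.

THE REMARK (bookkeeping on this seat's `…OddCutOfTranspositionWitness`, p811686).  The deep-witness clause of SUPPLY^± — a square-free `n` of
transposition-deep Kolyvagin primes with `P(n) ∉ 2W(K[n])` — is LOAD-BEARING ONLY AT FRAMES OF POSITIVE DEPTH `M₀ ≥ 1`: at a frame of exact depth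
`M₀ = 0` (`P(1) ∉ 2W(K[1])`, the classical Gross–Zagier–Kolyvagin `2`-primitivity bit of NDIV′) the clause holds with `n = 1`, `d = d₁` (no prime
condition to check), and the lower half `4^{M₀} ∣ #Ш(W_K)[2^∞]` is `1 ∣ _`.  Hence:
* §1 `transpositionWitness_of_depth_zero` — `P(1) ∉ 2W(K[1])` ⟹ the transposition-deep witness clause with `n = 1`.
* §2 `bsdp_onOddCut_of_depthZeroFrame_of_facts` — `BSD₂(Wd) → BSD₂(W)` on the odd habitat cut at a DEPTH-ZERO frame inside the genus budget,
  modulo Q2 + GZ + GZK + modularity + Milne (p811686 §4 at `M₀ = 0`, witness `(1, d₁)`).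
* §3 `minimalTwinBSDTwo_onOddCut_of_wall_of_depthZeroFrameSupply_of_facts` — **U₂ on the WHOLE odd habitat cut ⟸ WALL row 1 + PRINT + Q2 +
  FRAME⁰-SUPPLY** (per `W`: ONE odd Heegner frame `K ≠ ℚ(√−3)`, an odd-`c` datum, `P(1)` of infinite order and NOT `2`-divisible in `W(K[1])`, and a
  globally minimal twin model inside the budget `(Δ_W < 0 ∧ ord₂ C(Wd) ≤ 1) ∨ ord₂ C(Wd) = 0`) — the census reading «on the cut, at door-open /
  depth-zero frames, U₂'s research content is the single bit `y_K ∉ 2W(K)`» made kernel-explicit.  FRAME⁰-SUPPLY is OPEN (Kolyvagin's conjecture at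
  `2` in its weakest form + the existence of a budget frame with `L(W^{(d_K)},1) ≠ 0`); nothing beyond print is proved.

References: [Kolyvagin1989Izv] Thm. A, Thm. B_l; [GrossZagier1986] V.§2 (2.2); [GrossLMS1991] §3; [WZhang2014] Thm. 1.1 (p ≥ 5 analogue).
-/

set_option autoImplicit false
set_option linter.dupNamespace false -- `Summit.<P>.<Sub>` repeats `BirchSwinnertonDyer` (D-0017)

noncomputable section

open scoped Classical

namespace Summit.BirchSwinnertonDyer.BirchSwinnertonDyer.Theorems.GenusExact.TwinSwap.TwinAnnihilation

open Literature.NumberTheory.EllipticCurves Literature.NumberTheory.GaloisRepresentations WeierstrassCurve NumberField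
  IsDedekindDomain Field AddSubgroup Literature.NumberTheory.EllipticCurves.ModularForms
open Summit.BirchSwinnertonDyer.Rank1Residual
open Summit.BirchSwinnertonDyer.BirchSwinnertonDyer.Theses.GenusKolyvaginAtTwo (KolyvaginRelationAtTwo)

/-! ## §1 At depth zero the witness is the frame -/

/-- **At a frame of exact depth `M₀ = 0` the transposition-deep witness clause holds with `n = 1`, `d = d₁`**: `1` is square-free, has no prime
factors, and `P(1) ∉ 2W(K[1])` is the hypothesis.  Pure bookkeeping. [cite: GrossLMS1991, §3] -/
theorem transpositionWitness_of_depth_zero (W : WeierstrassCurve ℚ) [W.IsElliptic] [W.IsGloballyMinimal] [NeZero (W.conductorNorm ℤ)]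
    (K : Type) [Field K] [NumberField K] {Dt : ModularParametrizationData W (W.conductorNorm ℤ)} {β : ℤ} {ι : K →+* ℂ}
    (d₁ : KolyvaginHeegnerData Dt β ι 1)
    (hndiv : ¬ ∃ Q : (W.baseChange (ringClassField K ι 1)).toAffine.Point, (2 : ℤ) • Q = d₁.derivedPoint) :
    ∃ (n : ℕ) (d : KolyvaginHeegnerData Dt β ι n), Squarefree n ∧
      (∀ ℓ ∈ n.primeFactors, Zhang2014.IsKolyvaginPrime (W.conductorNorm ℤ) W K 2 ℓ ∧ 2 ≤ Zhang2014.kolyvaginIndex W 2 ℓ ∧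
        ∃ (v : HeightOneSpectrum (𝓞 ℚ)) (𝔓 : Ideal (absIntegers (𝓞 ℚ) ℚ)) (h : absoluteGaloisGroup ℚ),
          ((ℓ : ℕ) : 𝓞 ℚ) ∈ v.asIdeal ∧ 𝔓 ∈ v.primesAbove ∧ IsArithFrobAt (𝓞 ℚ) h 𝔓 ∧ ∃ u : W.geomTorsion ((2 : ℕ) : ℤ), h • u ≠ u) ∧
      ¬ ∃ Q : (W.baseChange (ringClassField K ι n)).toAffine.Point, (2 : ℤ) • Q = d.derivedPoint :=
  ⟨1, d₁, squarefree_one, fun ℓ hℓ ↦ absurd hℓ (by simp [Nat.primeFactors_one]), hndiv⟩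

/-! ## §2 `BSD₂(Wd) → BSD₂(W)` at a depth-zero frame of the cut -/

/-- **`BSD₂(Wd) → BSD₂(W)` on the odd habitat cut at a DEPTH-ZERO frame** (`P(1)` of infinite order and `P(1) ∉ 2W(K[1])`; `K` odd Heegner
`≠ ℚ(√−3)`; `Dt.c` odd; `Wd ≅ W^{(d_K)}` globally minimal inside the genus budget), modulo Q2 + GZ + GZK + modularity + Milne: p811686 §4
`bsdp_onOddCut_of_transpositionWitness_of_facts` at `M₀ = 0` with the witness `(1, d₁)` of §1 (the lower half is `1 ∣ _`; all the content is the
sign-free upper half).  CONDITIONAL; closes nothing; BSD is NOT proved. [cite: Kolyvagin1989Izv, Thm. B_l] [cite: GrossZagier1986, V.§2 (2.2)] -/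
theorem bsdp_onOddCut_of_depthZeroFrame_of_facts (hQ2 : KolyvaginRelationAtTwo)
    (hGZ : ∀ (N : ℕ) [NeZero N] (W : WeierstrassCurve ℚ) (K : Type) [Field K] [NumberField K], gross_zagier N W K)
    (hGZK : rank_eq_analyticRank_of_analyticRank_le_one) (hmod : hasEntireLFunction_rat)
    (hMilneC : Milne1972.bsdQuotient_baseChange_quadratic_anyModel)
    (W : WeierstrassCurve ℚ) [W.IsElliptic] [W.IsGloballyMinimal] [NeZero (W.conductorNorm ℤ)] (hcm : ¬ W.HasCM)
    (hr : W.analyticRank = 1) (hSel : Nat.card (W.selmerGroup 2) = 2)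
    (hT : Odd W.tamagawaProduct) (v : HeightOneSpectrum (𝓞 ℚ)) (h2v : ((2 : ℕ) : 𝓞 ℚ) ∉ v.asIdeal)
    (hNv : ((W.conductorNorm ℤ : ℕ) : 𝓞 ℚ) ∈ v.asIdeal) (hmult : W.HasMultiplicativeReductionAt v)
    (hρ : ∀ n : ℕ, 0 < n → W.HasSurjectiveModNGaloisRep ((2 : ℤ) ^ n))
    (K : Type) [Field K] [NumberField K] (hK : IsImaginaryQuadratic K) (hodd : Odd (NumberField.discr K))
    (h3 : NumberField.discr K ≠ -3) (hH : SatisfiesHeegnerHypothesis (W.conductorNorm ℤ) K)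
    (Dt : ModularParametrizationData W (W.conductorNorm ℤ)) (hc : Odd Dt.c) (β : ℤ) (ι : K →+* ℂ) (d₁ : KolyvaginHeegnerData Dt β ι 1)
    (hy : ¬ IsOfFinAddOrder d₁.derivedPoint)
    (hndiv : ¬ ∃ Q : (W.baseChange (ringClassField K ι 1)).toAffine.Point, (2 : ℤ) • Q = d₁.derivedPoint)
    (Wd : WeierstrassCurve ℚ) [Wd.IsElliptic] [Wd.IsGloballyMinimal]
    (hWd : ∃ C : VariableChange ℚ, C • W.quadraticTwist (NumberField.discr K : ℚ) = Wd)
    (hbudget : (W.Δ < 0 ∧ padicValNat 2 Wd.tamagawaProduct ≤ 1) ∨ padicValNat 2 Wd.tamagawaProduct = 0) (hBSDd : BSDp Wd 2) :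
    BSDp W 2 := by
  obtain ⟨n, d, hn, hdeep, hPn⟩ := transpositionWitness_of_depth_zero W K d₁ hndiv
  have hdiv0 : ∃ Q : (W.baseChange (ringClassField K ι 1)).toAffine.Point, ((2 ^ 0 : ℕ) : ℤ) • Q = d₁.derivedPoint :=
    ⟨d₁.derivedPoint, by simp⟩
  have hndiv0 : ¬ ∃ Q : (W.baseChange (ringClassField K ι 1)).toAffine.Point, ((2 ^ (0 + 1) : ℕ) : ℤ) • Q = d₁.derivedPoint := by
    simpa using hndiv
  exact bsdp_onOddCut_of_transpositionWitness_of_facts hQ2 hGZ hGZK hmod hMilneC W hcm hr hSel hT v h2v hNv hmult hρ K hK hodd h3 hH Dt hc β ι d₁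
    hy 0 hdiv0 hndiv0 Wd hWd hbudget hBSDd n d hn hdeep hPn

/-! ## §3 U₂ on the cut from WALL row 1 + PRINT + Q2 + a depth-zero frame supply -/

/-- **U₂ ON THE WHOLE ODD HABITAT CUT ⟸ WALL row 1 + PRINT + Q2 + FRAME⁰-SUPPLY.**  Displayed hypotheses: S1′ (`BSD₂` for non-CM globally minimal
curves of analytic rank `0`); the four PRINT facts; Q2; and FRAME⁰-SUPPLY: for every `W` on the cut (non-CM, `r_an = 1`, `#Sel₂ = 2`, `C(W)` odd,
`ρ_{W,2^∞}` onto, an odd multiplicative prime) ONE odd Heegner frame `K ≠ ℚ(√−3)`, an odd-`c` datum, a conductor-`1` datum whose `P(1)` has infinite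
order and is NOT `2`-divisible in `W(K[1])` (depth zero), and a globally minimal twin model inside the budget.  Then `BSD₂(W)` on the cut (§2; the
twin is non-CM of analytic rank `0` by Gross–Zagier, so S1′ pays `BSD₂(Wd)`).  FRAME⁰-SUPPLY ⟹ SUPPLY^± (§1); it is OPEN; CONDITIONAL; closes
nothing; BSD is NOT proved. [cite: Kolyvagin1989Izv, Thm. A, Thm. B_l] [cite: GrossZagier1986, V.§2 (2.2)] [cite: WZhang2014, Thm. 1.1] -/
theorem minimalTwinBSDTwo_onOddCut_of_wall_of_depthZeroFrameSupply_of_facts (hQ2 : KolyvaginRelationAtTwo)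
    (hGZ : ∀ (N : ℕ) [NeZero N] (W : WeierstrassCurve ℚ) (K : Type) [Field K] [NumberField K], gross_zagier N W K)
    (hGZK : rank_eq_analyticRank_of_analyticRank_le_one) (hmod : hasEntireLFunction_rat)
    (hMilneC : Milne1972.bsdQuotient_baseChange_quadratic_anyModel)
    (hS1 : ∀ (W : WeierstrassCurve ℚ) [W.IsElliptic] [W.IsGloballyMinimal], ¬ W.HasCM → W.analyticRank = 0 → BSDp W 2)
    (hSupply0 : ∀ (W : WeierstrassCurve ℚ) [W.IsElliptic] [W.IsGloballyMinimal] [NeZero (W.conductorNorm ℤ)],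
      ¬ W.HasCM → W.analyticRank = 1 → Nat.card (W.selmerGroup 2) = 2 → Odd W.tamagawaProduct →
      (∀ n : ℕ, 0 < n → W.HasSurjectiveModNGaloisRep ((2 : ℤ) ^ n)) →
      (∃ v : HeightOneSpectrum (𝓞 ℚ), ((2 : ℕ) : 𝓞 ℚ) ∉ v.asIdeal ∧ ((W.conductorNorm ℤ : ℕ) : 𝓞 ℚ) ∈ v.asIdeal ∧ W.HasMultiplicativeReductionAt v) →
      ∃ (K : Type) (_ : Field K) (_ : NumberField K), IsImaginaryQuadratic K ∧ Odd (NumberField.discr K) ∧ NumberField.discr K ≠ -3 ∧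
        SatisfiesHeegnerHypothesis (W.conductorNorm ℤ) K ∧
        ∃ (Dt : ModularParametrizationData W (W.conductorNorm ℤ)) (β : ℤ) (ι : K →+* ℂ) (d₁ : KolyvaginHeegnerData Dt β ι 1),
          Odd Dt.c ∧ ¬ IsOfFinAddOrder d₁.derivedPoint ∧
          (¬ ∃ Q : (W.baseChange (ringClassField K ι 1)).toAffine.Point, (2 : ℤ) • Q = d₁.derivedPoint) ∧
          ∃ (Wd : WeierstrassCurve ℚ) (_ : Wd.IsElliptic) (_ : Wd.IsGloballyMinimal),
            (∃ C : VariableChange ℚ, C • W.quadraticTwist (NumberField.discr K : ℚ) = Wd) ∧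
              ((W.Δ < 0 ∧ padicValNat 2 Wd.tamagawaProduct ≤ 1) ∨ padicValNat 2 Wd.tamagawaProduct = 0)) :
    ∀ (W : WeierstrassCurve ℚ) [W.IsElliptic] [W.IsGloballyMinimal] [NeZero (W.conductorNorm ℤ)],
      ¬ W.HasCM → W.analyticRank = 1 → Nat.card (W.selmerGroup 2) = 2 → Odd W.tamagawaProduct →
      (∀ n : ℕ, 0 < n → W.HasSurjectiveModNGaloisRep ((2 : ℤ) ^ n)) →
      (∃ v : HeightOneSpectrum (𝓞 ℚ), ((2 : ℕ) : 𝓞 ℚ) ∉ v.asIdeal ∧ ((W.conductorNorm ℤ : ℕ) : 𝓞 ℚ) ∈ v.asIdeal ∧ W.HasMultiplicativeReductionAt v) →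
      BSDp W 2 := by
  intro W _ _ _ hcm hr hSel hT hρ hv
  obtain ⟨K, _, _, hK, hodd, h3, hH, Dt, β, ι, d₁, hc, hy, hndiv, Wd, _, _, ⟨Cd, hCd⟩, hbudget⟩ := hSupply0 W hcm hr hSel hT hρ hv
  obtain ⟨v, h2v, hNv, hmult⟩ := hv
  -- the twin model is non-CM (same `j`) of analytic rank `0` (Gross–Zagier), so `BSD₂(Wd)` by S1′
  have hD0 : (NumberField.discr K : ℚ) ≠ 0 := by exact_mod_cast NumberField.discr_ne_zero K
  haveI hTell : (W.quadraticTwist (NumberField.discr K : ℚ)).IsElliptic := W.isElliptic_quadraticTwist hD0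
  obtain ⟨Ph, hPh, hPhmap⟩ := AdditiveKoly.exists_isHeegnerPoint_map_eq_derivedPoint_one (W := W) (K := K) (Dt := Dt) (β := β)
    (ι := ι) hK hH d₁
  have hPinf : ¬ IsOfFinAddOrder Ph := by
    intro hfin
    apply hy
    rw [← hPhmap]
    exact (WeierstrassCurve.Affine.Point.map (W' := W) (algebraMap K (ringClassField K ι 1)).toRatAlgHom).isOfFinAddOrder hfin
  have hrT : (W.quadraticTwist (NumberField.discr K : ℚ)).analyticRank = 0 :=
    analyticRank_twist_eq_zero_of_rankOne W K (hGZ _ W K) hmod hK hH hr hPh hPinf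
  subst hCd
  have hcmd : ¬ (Cd • W.quadraticTwist (NumberField.discr K : ℚ)).HasCM := by
    rw [hasCM_iff_of_j_eq (((W.quadraticTwist (NumberField.discr K : ℚ)).variableChange_j Cd).trans (W.j_quadraticTwist hD0))]
    exact hcm
  have hrd : (Cd • W.quadraticTwist (NumberField.discr K : ℚ)).analyticRank = 0 := by
    rw [analyticRank_smul]
    exact hrT
  exact bsdp_onOddCut_of_depthZeroFrame_of_facts hQ2 hGZ hGZK hmod hMilneC W hcm hr hSel hT v h2v hNv hmult hρ K hK hodd h3 hH Dt hc β ι d₁ hy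
    hndiv (Cd • W.quadraticTwist (NumberField.discr K : ℚ)) ⟨Cd, rfl⟩ hbudget (hS1 _ hcmd hrd)

end Summit.BirchSwinnertonDyer.BirchSwinnertonDyer.Theorems.GenusExact.TwinSwap.TwinAnnihilation

end
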